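import Literature.NumberTheory.Rogawski1990.LocalStableClassesRankTwoCompactSideCount   -- ★ p842300 (CNT-b) FILE C: the four clause heads over the β-set
import Literature.NumberTheory.Rogawski1990.LocalNormFibreDockBlockIsotropic          -- ★ p842309 (CNT-b) FILE D: `−det G₁′ ∉ N` from the dock
import Literature.NumberTheory.Rogawski1990.LocalNormFibreBadFrameClassesCount        -- ★ p842261 (CNT-a) FILE 3: `finite_iff_and_ncard_eq_matched_badFrame` (+ ★ FILE 2 `matched_badFrame_block`)
import HarnessLib

/-!
# (CNT) ASSEMBLED: the matched-class count `hcnt` of the compact-side junction at the bad-frame predicate `Q′`, BY NAME from (CNT-a) ★ p842136∕p842176∕p842261 (F0P3a-p08) and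
# (CNT-b) ★ p842187∕p842218∕p842300∕p842309 (B-p04) (Rogawski 1990, §8.1 Prop. 8.1.3 pp. 110–111)

Topic `NumberTheory/Rogawski1990`; namespace `Literature.NumberTheory.Rogawski1990`.  THEOREMS ONLY (no definition, no instance, no notation, no named fact, no `sorry`).
Cell `pub/hodgecm-mathlib` (D-0151), crux H413 = `stmt-HodgeConjecture-24833`, floor-2 line «N6nsGerm» (`Cruxes/H413/Lines/F0_P3a_N6nsGerm.lean`), stub `stub_N6nsS1` ∕ `stub_N6nsS1pkg`
(ED. 1.4∕1.5 candidates, pen F0P2-p02 (g8), assembler A-p14 (g28) per LEAD F0P3a-plan (g9) WORDS T8-137∕T8-138): the binder `hcnt` of ★ B-p08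
`exists_nhds_finsum_side_eq_stableOrbitalIntegralRel_of_compact_dock` (`LocalTransferCompactSideJunctionCM` :202–:211) at
`Q′ := fun γH g => ∃ B, g.val.val * P′.val = P′.val * finSum 2 1 B γH.2.val.val` (the bad frame `P′` of ★ `exists_badFrame_dock`), with `Vc := univ`.  Seat B-p04 (g34).
HONEST LABEL: HC_CM is proved only modulo the printed citations until rung 0 closes; this file is an assembly of ★ theorems and pays no printed letter.

THE MATHEMATICS.  For every `G`-regular `γ_H`: (CNT-a) puts the `Q′`-side matched classes in bijection with `S := {β : ConjClasses ↥U(G₁′) | χ_{out β} = χ_{γ_H.1}}`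
(finiteness transfers, `ncard`s agree); (CNT-b): `S` is finite, the `H_v`-stable class of `γ_H` is finite, `#S = #(H_v-stable class)` when `Z(γ_H.1)` is compact, and `S = ∅` when it is
not — the last because the bad block `G₁′` is anisotropic (`−det G₁′ ∉ N`, from the DOCK: the dock block carries `U(1,1)` hence is isotropic, and `det G₁′ ∉ det G₁ · N`).

References: [Rogawski1990] §8.1 Prop. 8.1.3 pp. 110–111, §3.8 Prop. 3.8.1 (d) p. 30, §3.5 Prop. 3.5.2 (c) p. 29.
-/

set_option autoImplicit false

noncomputable section

open NumberField IsDedekindDomain Polynomial Filter Topology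
open Matrix hiding mem_unitaryGroup_iff unitaryGroup
open scoped MatrixGroups

namespace Literature.NumberTheory.Rogawski1990

open Literature.NumberTheory.Automorphic
open Literature.NumberTheory.Automorphic.UnitaryGroup hiding hermForm hermForm_apply hermForm_mulVec
open Literature.AlgebraicGeometry.ShimuraVarieties (unitaryGroup mem_unitaryGroup_iff)

section CM

variable (L : Type) [Field L] [NumberField L] [IsCMField L] (H' : Matrix (Fin 3) (Fin 3) L) (v : HeightOneSpectrum (𝓞 ↥(maximalRealSubfield L)))
  (w : PlacesOver L v) (hw : IsCMField.complexConj L • w.1 = w.1)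

/-- The blocks of a block-diagonal Gram matrix `ᵗσ(P′) H′_v P′ = G₁′ ⊕ᶠ G₂′` of the hermitian unit-determinant `H′_v`: `G₁′` is hermitian with unit determinant.
[cite: Rogawski1990, §3.8 Prop. 3.8.1 (d) p. 30] -/
theorem badBlock_herm_and_isUnit_det (hH' : (H'.map (cmConjRingHom L))ᵀ = H') (hdet' : H'.det ≠ 0) {P' : GL (Fin (2 + 1)) (LocalRing L v)}
    {G₁' : Matrix (Fin 2) (Fin 2) (LocalRing L v)} {G₂' : Matrix (Fin 1) (Fin 1) (LocalRing L v)} (hP' : twistGram (conjLocal L (IsCMField.complexConj L) v) ((adelicForm L 3 H').map (adeleToLocal L v)) P'.val = finSum 2 1 G₁' G₂') :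
    (G₁'.map (conjLocal L (IsCMField.complexConj L) v))ᵀ = G₁' ∧ IsUnit G₁'.det := by
  have hσσ : ∀ x : (LocalRing L v), (conjLocal L (IsCMField.complexConj L) v) ((conjLocal L (IsCMField.complexConj L) v) x) = x := conjLocal_conjLocal (IsCMField.complexConj L) v
    (GelbartRogawski1991.UnitaryDualPair.complexConj_imagUnit L) (GelbartRogawski1991.UnitaryDualPair.imagUnit_ne_zero L)
  have hHv := map_conjLocal_transpose_localForm L 3 H' v hH'
  have hHvd := isUnit_det_localForm L 3 H' v hdet'
  have hGh : ((finSum 2 1 G₁' G₂').map (conjLocal L (IsCMField.complexConj L) v))ᵀ = finSum 2 1 G₁' G₂' := by rw [← hP']; exact conjTranspose_twistGram (conjLocal L (IsCMField.complexConj L) v) _ hσσ hHv P'.val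
  refine ⟨Matrix.ext fun i j => ?_, ?_⟩
  · rw [Matrix.transpose_apply, Matrix.map_apply]
    fin_cases i <;> fin_cases j
    · have h := congrFun (congrFun hGh 0) 0
      rw [Matrix.transpose_apply, Matrix.map_apply] at h
      simpa [finSum, Matrix.fromBlocks, finSumFinEquiv, Fin.addCases] using h
    · have h := congrFun (congrFun hGh 0) 1
      rw [Matrix.transpose_apply, Matrix.map_apply] at h
      simpa [finSum, Matrix.fromBlocks, finSumFinEquiv, Fin.addCases] using h
    · have h := congrFun (congrFun hGh 1) 0
      rw [Matrix.transpose_apply, Matrix.map_apply] at h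
      simpa [finSum, Matrix.fromBlocks, finSumFinEquiv, Fin.addCases] using h
    · have h := congrFun (congrFun hGh 1) 1
      rw [Matrix.transpose_apply, Matrix.map_apply] at h
      simpa [finSum, Matrix.fromBlocks, finSumFinEquiv, Fin.addCases] using h
  · have hd : IsUnit (twistGram (conjLocal L (IsCMField.complexConj L) v) ((adelicForm L 3 H').map (adeleToLocal L v)) P'.val).det := by
      rw [det_twistGram]
      have hPu : IsUnit P'.val.det := by have hh := P'.isUnit; rwa [Matrix.isUnit_iff_isUnit_det] at hh
      exact ((hPu.map _).mul hHvd).mul hPu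
    rw [hP', det_finSum] at hd
    exact isUnit_of_mul_isUnit_left hd

include hw in
/-- **(CNT) — THE MATCHED-CLASS COUNT `hcnt` AT THE BAD FRAME, BY NAME.**  Data: `H′` hermitian non-degenerate, `v` non-split, the dock `θ : H_v ≃ₜ* Z(ε)` (`θ z = y ι(z) y⁻¹`),
the swap `W`, the dock frame Gram `ᵗσ(yW) H′_v (yW) = G₁ ⊕ᶠ G₂`, a bad frame `ᵗσ(P′) H′_v P′ = G₁′ ⊕ᶠ G₂′` with `det G₁′ ∉ det G₁ · N` (★ `exists_badFrame_dock`).  Conclusion = the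
`hcnt` binder of ★ `exists_nhds_finsum_side_eq_stableOrbitalIntegralRel_of_compact_dock` at `Q′ γH g := ∃ B, g·P′ = P′·(B ⊕ᶠ γH.2)`, with `Vc := univ` (any `ε_H`).
[cite: Rogawski1990, §8.1 Prop. 8.1.3 pp. 110–111; §3.8 Prop. 3.8.1 (d) p. 30] -/
theorem exists_nhds_matched_badFrame_count (hH' : (H'.map (cmConjRingHom L))ᵀ = H') (hdet' : H'.det ≠ 0) (εH : ((cmDatum L 2 (Matrix.of fun i j : Fin 2 => if i.val + j.val + 1 = 2 then (1 : L) else 0)).Local v × (cmDatum L 1 (Matrix.of fun i j : Fin 1 => if i.val + j.val + 1 = 1 then (1 : L) else 0)).Local v))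
    {ε : ((cmDatum L 3 H').Local v)} {y : GL (Fin 3) (LocalRing L v)} (θ : ((cmDatum L 2 (Matrix.of fun i j : Fin 2 => if i.val + j.val + 1 = 2 then (1 : L) else 0)).Local v × (cmDatum L 1 (Matrix.of fun i j : Fin 1 => if i.val + j.val + 1 = 1 then (1 : L) else 0)).Local v) ≃ₜ* ↥(Subgroup.centralizer ({ε} : Set ((cmDatum L 3 H').Local v))))
    (hθ : ∀ z : ((cmDatum L 2 (Matrix.of fun i j : Fin 2 => if i.val + j.val + 1 = 2 then (1 : L) else 0)).Local v × (cmDatum L 1 (Matrix.of fun i j : Fin 1 => if i.val + j.val + 1 = 1 then (1 : L) else 0)).Local v), (((θ z).1).val : GL (Fin 3) (LocalRing L v)) = y * ((endoEmbLocal L v z).val : GL (Fin 3) (LocalRing L v)) * y⁻¹)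
    {W : GL (Fin 3) (LocalRing L v)} (hW : W.val = !![(1 : (LocalRing L v)), 0, 0; 0, 0, 1; 0, 1, 0])
    {G₁ G₁' : Matrix (Fin 2) (Fin 2) (LocalRing L v)} {G₂ G₂' : Matrix (Fin 1) (Fin 1) (LocalRing L v)} {P' : GL (Fin (2 + 1)) (LocalRing L v)}
    (hPW : twistGram (conjLocal L (IsCMField.complexConj L) v) ((adelicForm L 3 H').map (adeleToLocal L v)) (y * W).val = finSum 2 1 G₁ G₂)
    (hP' : twistGram (conjLocal L (IsCMField.complexConj L) v) ((adelicForm L 3 H').map (adeleToLocal L v)) P'.val = finSum 2 1 G₁' G₂')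
    (hnn : ¬ ∃ z : (LocalRing L v), IsUnit z ∧ G₁'.det = G₁.det * ((conjLocal L (IsCMField.complexConj L) v) z * z)) :
    ∃ Vc ∈ 𝓝 εH, ∀ γH ∈ Vc, IsLocalGRegular L v γH →
      {c : ConjClasses ((cmDatum L 3 H').Local v) | (∃ x : ((cmDatum L 3 H').Local v), ∃ B : Matrix (Fin 2) (Fin 2) (LocalRing L v), ((x * Quotient.out c * x⁻¹).val.val : Matrix (Fin 3) (Fin 3) (LocalRing L v)) * P'.val = P'.val * finSum 2 1 B (γH.2.val.val : Matrix (Fin 1) (Fin 1) (LocalRing L v))) ∧ IsLocalNormPair L H' v γH (Quotient.out c)}.Finite ∧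
      {d : ConjClasses ((cmDatum L 2 (Matrix.of fun i j : Fin 2 => if i.val + j.val + 1 = 2 then (1 : L) else 0)).Local v × (cmDatum L 1 (Matrix.of fun i j : Fin 1 => if i.val + j.val + 1 = 1 then (1 : L) else 0)).Local v) | IsLocalStablyConjH L v γH (Quotient.out d)}.Finite ∧
      (CompactSpace (Subgroup.centralizer ({γH.1} : Set ((cmDatum L 2 (Matrix.of fun i j : Fin 2 => if i.val + j.val + 1 = 2 then (1 : L) else 0)).Local v))) → {c : ConjClasses ((cmDatum L 3 H').Local v) | (∃ x : ((cmDatum L 3 H').Local v), ∃ B : Matrix (Fin 2) (Fin 2) (LocalRing L v), ((x * Quotient.out c * x⁻¹).val.val : Matrix (Fin 3) (Fin 3) (LocalRing L v)) * P'.val = P'.val * finSum 2 1 B (γH.2.val.val : Matrix (Fin 1) (Fin 1) (LocalRing L v))) ∧ IsLocalNormPair L H' v γH (Quotient.out c)}.ncard = {d : ConjClasses ((cmDatum L 2 (Matrix.of fun i j : Fin 2 => if i.val + j.val + 1 = 2 then (1 : L) else 0)).Local v × (cmDatum L 1 (Matrix.of fun i j : Fin 1 => if i.val + j.val + 1 =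 1 then (1 : L) else 0)).Local v) | IsLocalStablyConjH L v γH (Quotient.out d)}.ncard) ∧
      (¬ CompactSpace (Subgroup.centralizer ({γH.1} : Set ((cmDatum L 2 (Matrix.of fun i j : Fin 2 => if i.val + j.val + 1 = 2 then (1 : L) else 0)).Local v))) →
        ∀ c : ConjClasses ((cmDatum L 3 H').Local v), (∃ x : ((cmDatum L 3 H').Local v), ∃ B : Matrix (Fin 2) (Fin 2) (LocalRing L v),
          ((x * Quotient.out c * x⁻¹).val.val : Matrix (Fin 3) (Fin 3) (LocalRing L v)) * P'.val = P'.val * finSum 2 1 B (γH.2.val.val : Matrix (Fin 1) (Fin 1) (LocalRing L v))) →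
          ¬ IsLocalNormPair L H' v γH (Quotient.out c)) := by
  obtain ⟨hG₁', hG₁'d⟩ := badBlock_herm_and_isUnit_det L H' v hH' hdet' hP'
  have hanis := anisotropic_of_neg_det_not_norm L v w hw hG₁' hG₁'d (not_exists_neg_det_badBlock_eq_norm L H' v w hw hH' hdet' θ hθ hW hPW hnn)
  refine ⟨Set.univ, Filter.univ_mem, fun γH _ hreg => ?_⟩
  obtain ⟨hfin, hncard⟩ := finite_iff_and_ncard_eq_matched_badFrame L H' v w hw hP' hreg
  refine ⟨hfin.2 (finite_setOf_charpoly_out_eq_finCharpolyTwo L v w hw hG₁' hG₁'d γH hreg), finite_setOf_isLocalStablyConjH_out L v w hw γH hreg,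
    fun hZ => hncard.trans (ncard_setOf_charpoly_out_eq_eq_ncard_of_compactSpace L v w hw hG₁' hG₁'d γH hreg hZ), fun hZ c hQ hm => ?_⟩
  obtain ⟨x, B, hQ⟩ := hQ
  obtain ⟨hB, hBd, hχ⟩ := matched_badFrame_block L H' v hP' γH hm hQ
  obtain ⟨u, hu⟩ := exists_mem_unitaryGroup_coe_eq L v hB hBd
  exact forall_charpoly_ne_finCharpolyTwo_of_not_compactSpace L v w hw hanis γH hreg hZ u (by rw [hu]; exact hχ)

end CM

end Literature.NumberTheory.Rogawski1990

end
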